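import Summits.QuantumFields.QCD.Theorems.GaussianLinkFramesFrameFMClosurePlacementCollarAux3

/-!
# Crux `GaussianLinkFrames.FrameFMClosure` (stmt-QuantumFields-17375), line `pad-the-fibre`, stub
`stub_placementCollar` — helper 4: the one-point package and the two-point pairing (integer chart)

* `collar_point_package` — for every `a ∈ Λ̂ ∖ Ŵ` (`ℓ ≥ 1`): a pad centre `b` holding `a` in its core, frozen layers
  `(M, c)`, a region `Q` canonical for `(b, M, c)` with no link inside `Ŵ` and none inside `Λ̂ᶜ`, and finite sets
  `Z`, `D` with `Z ∪ D =` the endpoints of `star(a) ∪ Q`, `Z` stable under the aligned `0`-flip `τ`, `D` stable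
  under the complementary `0`-flip `τ'`, `Z` inside `Λ̂` off coordinate `0`, `D` outside `Λ̂` in a coordinate `≠ 0`,
  all inside the window `[-3ℓ-4, 3ℓ+3]⁴` (helpers 1–3 assembled).
* `collar_pairing` — for TWO such points the map `σ = τ'` on `D₁ ∪ D₂`, `σ = τ` elsewhere, is a nearest-neighbour
  involution of `(Z₁ ∪ D₁) ∪ (Z₂ ∪ D₂)`: the blocks and the defects never meet, and `τ`, `τ'` are GLOBAL involutions,
  so the two placements glue with no case analysis on the relative position of the points (close points, corners
  of `Λ` and edges included).

References: placement recipe of the line card `pad-the-fibre` (triage r1-1 sharpen 1); elementary [folklore].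
-/

noncomputable section

open scoped BigOperators
open Literature.Probability.LatticeModels

namespace Summit.QuantumFields.QCD.Theorems.PadTheFibreCollar

/-- **The one-point package of the collar recipe** (integer chart). [folklore] -/
theorem collar_point_package (ℓ : ℕ) (hℓ : 1 ≤ ℓ) (a : Site 4)
    (haΛ : ∀ i, -(3 * (ℓ : ℤ) + 3) ≤ a i ∧ a i ≤ 3 * ℓ + 2) (haW : ¬ ∀ i, -(ℓ : ℤ) - 1 ≤ a i ∧ a i ≤ ℓ) :
    ∃ (b c : Site 4) (M : Finset (Fin 4)) (Q : Finset (Site 4 × Fin 4)) (Z D : Finset (Site 4)),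
      (∀ i, a i - b i = 0 ∨ a i - b i = -1) ∧
      (∀ i, -(3 * (ℓ : ℤ) + 2) ≤ b i ∧ b i ≤ 3 * ℓ + 2) ∧
      (∀ k ∈ M, c k = -2 ∨ c k = 1) ∧
      (∀ w : Site 4, (∀ i, -2 ≤ w i ∧ w i ≤ 1) → ∀ μ : Fin 4,
        (∀ i, -2 ≤ (w + Pi.single μ 1 : Site 4) i ∧ (w + Pi.single μ 1 : Site 4) i ≤ 1) →
        (¬ ∃ k ∈ M, w k = c k) → (¬ ∃ k ∈ M, (w + Pi.single μ 1 : Site 4) k = c k) → (b + w, μ) ∈ Q) ∧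
      (∀ q ∈ Q, ∃ w : Site 4, (∀ i, -2 ≤ w i ∧ w i ≤ 1) ∧
        (∀ i, -2 ≤ (w + Pi.single q.2 1 : Site 4) i ∧ (w + Pi.single q.2 1 : Site 4) i ≤ 1) ∧
        q.1 = b + w ∧ ¬ ((∃ k ∈ M, w k = c k) ∧ (∃ k ∈ M, (w + Pi.single q.2 1 : Site 4) k = c k))) ∧
      (∀ q ∈ Q, ¬ ((∀ i, -(ℓ : ℤ) - 1 ≤ q.1 i ∧ q.1 i ≤ ℓ) ∧
        (∀ i, -(ℓ : ℤ) - 1 ≤ (q.1 + Pi.single q.2 1 : Site 4) i ∧ (q.1 + Pi.single q.2 1 : Site 4) i ≤ ℓ))) ∧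
      (∀ q ∈ Q, (∀ i, -(3 * (ℓ : ℤ) + 3) ≤ q.1 i ∧ q.1 i ≤ 3 * ℓ + 2) ∨
        (∀ i, -(3 * (ℓ : ℤ) + 3) ≤ (q.1 + Pi.single q.2 1 : Site 4) i ∧
          (q.1 + Pi.single q.2 1 : Site 4) i ≤ 3 * ℓ + 2)) ∧
      (∀ y : Site 4, (y ∈ Z ∨ y ∈ D) ↔
        ((y = a ∨ ∃ μ : Fin 4, y = a + Pi.single μ 1 ∨ y = a - Pi.single μ 1) ∨
          ∃ q ∈ Q, q.1 = y ∨ q.1 + Pi.single q.2 1 = y)) ∧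
      (∀ y ∈ Z, (if (y 0 - (ℓ : ℤ)) % 2 = 0 then y + Pi.single 0 1 else y - Pi.single 0 1) ∈ Z) ∧
      (∀ y ∈ D, (if (y 0 - (ℓ : ℤ)) % 2 = 0 then y - Pi.single 0 1 else y + Pi.single 0 1) ∈ D) ∧
      (∀ y ∈ Z, ∀ k : Fin 4, k ≠ 0 → -(3 * (ℓ : ℤ) + 3) ≤ y k ∧ y k ≤ 3 * ℓ + 2) ∧
      (∀ y ∈ D, ∃ k : Fin 4, k ≠ 0 ∧ (y k < -(3 * (ℓ : ℤ) + 3) ∨ 3 * (ℓ : ℤ) + 2 < y k)) ∧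
      (∀ y : Site 4, y ∈ Z ∨ y ∈ D → ∀ i, -(3 * (ℓ : ℤ) + 4) ≤ y i ∧ y i ≤ 3 * ℓ + 3) := by
  obtain ⟨b, hcore, hb, hpar, ⟨j, hj⟩, hface, hface'⟩ := collar_data_b ℓ hℓ a haΛ haW
  -- the frozen layers, excluded coordinates and free coordinate (inner / outer pads)
  obtain ⟨c, M, E, d₀, hc, hEM, h0E, hd₀, hME, hadj, hW, hΛ, hDout⟩ :
      ∃ (c : Site 4) (M E : Finset (Fin 4)) (d₀ : Fin 4),
      (∀ k ∈ M, c k = -2 ∨ c k = 1) ∧ E ⊆ M ∧ (0 : Fin 4) ∉ E ∧ d₀ ∉ E ∧ (∀ k ∈ M, k ∈ E ∨ k = d₀) ∧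
      (∀ k ∈ E, (c k = 1 → a k - b k = 0) ∧ (c k = -2 → a k - b k = -1)) ∧
      (∀ w : Site 4, (∀ i, -2 ≤ w i ∧ w i ≤ 1) → (∀ i, -(ℓ : ℤ) - 1 ≤ b i + w i ∧ b i + w i ≤ ℓ) →
        ∃ k ∈ M, w k = c k) ∧
      (∀ w : Site 4, (∀ i, -2 ≤ w i ∧ w i ≤ 1) → ∀ k : Fin 4,
        (b k + w k < -(3 * (ℓ : ℤ) + 3) ∨ 3 * (ℓ : ℤ) + 2 < b k + w k) → (k ∈ E ∨ k = 0) ∧ k ∈ M ∧ w k = c k) ∧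
      (∀ k ∈ E, (c k = 1 → a k = 3 * ℓ + 2) ∧ (c k = -2 → a k = -(3 * (ℓ : ℤ) + 3))) := by
    by_cases hin : ∀ i, -(ℓ : ℤ) - 2 ≤ b i ∧ b i ≤ ℓ + 2
    · exact collar_data_inner ℓ hℓ a b hin j hj
    · refine collar_data_outer ℓ a b hb hface hface' ?_
      obtain ⟨k, hk⟩ := not_forall.1 hin
      exact ⟨k, by omega⟩
  obtain ⟨Z, D, Q, hZ, hD, hQ⟩ := collar_sets_exist ℓ a b c M E
  obtain ⟨h11, h12, h13⟩ := collar_location ℓ a b c M E Z D hZ hD hcore hpar hc hEM h0E hΛ hDout hb haΛ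
  exact ⟨b, c, M, Q, Z, D, hcore, hb, hc,
    fun w hw μ hw' hfr hfr' => collar_lower ℓ a b c M E Z Q hZ hQ hEM w hw μ hw' hfr hfr',
    fun q hq => collar_upper ℓ a b c M E Z Q hZ hQ hcore hpar hc hEM q hq,
    fun q hq => collar_noW ℓ a b c M E Z Q hZ hQ hcore hpar hc hEM hW q hq,
    fun q hq => collar_noΛ ℓ a b c M E Z Q hZ hQ hcore hpar hc hEM hΛ q hq,
    fun y => collar_touched ℓ a b c M E Z D Q hZ hD hQ hcore hpar hc hEM d₀ hd₀ hME hadj y,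
    fun y hy => collar_flip_Z ℓ b c E Z hZ hpar h0E y hy,
    fun y hy => collar_flip_D ℓ a c E D hD h0E y hy, h11, h12, h13⟩

/-- **Gluing two collar placements.**  The map `σ` (`= τ'` on the defects `D₁ ∪ D₂`, `= τ` elsewhere) is a
nearest-neighbour involution of `(Z₁ ∪ D₁) ∪ (Z₂ ∪ D₂)`. [folklore] -/
theorem collar_pairing (ℓ : ℕ) (Z₁ D₁ Z₂ D₂ : Finset (Site 4)) (τ τ' σ : Site 4 → Site 4)
    (hτ : ∀ y, τ y = if (y 0 - (ℓ : ℤ)) % 2 = 0 then y + Pi.single 0 1 else y - Pi.single 0 1)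
    (hτ' : ∀ y, τ' y = if (y 0 - (ℓ : ℤ)) % 2 = 0 then y - Pi.single 0 1 else y + Pi.single 0 1)
    (hσ : ∀ y, σ y = if y ∈ D₁ ∪ D₂ then τ' y else τ y)
    (hZ₁ : ∀ y ∈ Z₁, τ y ∈ Z₁) (hD₁ : ∀ y ∈ D₁, τ' y ∈ D₁)
    (hZ₁' : ∀ y ∈ Z₁, ∀ k : Fin 4, k ≠ 0 → -(3 * (ℓ : ℤ) + 3) ≤ y k ∧ y k ≤ 3 * ℓ + 2)
    (hD₁' : ∀ y ∈ D₁, ∃ k : Fin 4, k ≠ 0 ∧ (y k < -(3 * (ℓ : ℤ) + 3) ∨ 3 * (ℓ : ℤ) + 2 < y k))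
    (hZ₂ : ∀ y ∈ Z₂, τ y ∈ Z₂) (hD₂ : ∀ y ∈ D₂, τ' y ∈ D₂)
    (hZ₂' : ∀ y ∈ Z₂, ∀ k : Fin 4, k ≠ 0 → -(3 * (ℓ : ℤ) + 3) ≤ y k ∧ y k ≤ 3 * ℓ + 2)
    (hD₂' : ∀ y ∈ D₂, ∃ k : Fin 4, k ≠ 0 ∧ (y k < -(3 * (ℓ : ℤ) + 3) ∨ 3 * (ℓ : ℤ) + 2 < y k))
    (y : Site 4) (hy : y ∈ (Z₁ ∪ D₁) ∪ (Z₂ ∪ D₂)) :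
    σ y ∈ (Z₁ ∪ D₁) ∪ (Z₂ ∪ D₂) ∧ σ (σ y) = y ∧
      ∃ μ : Fin 4, σ y = y + Pi.single μ 1 ∨ y = σ y + Pi.single μ 1 := by
  -- blocks and defects never meet
  have disj : ∀ z, z ∈ Z₁ ∪ Z₂ → z ∉ D₁ ∪ D₂ := by
    intro z hz hz'
    have hin : ∀ k : Fin 4, k ≠ 0 → -(3 * (ℓ : ℤ) + 3) ≤ z k ∧ z k ≤ 3 * ℓ + 2 := by
      rcases Finset.mem_union.1 hz with h | h
      · exact hZ₁' z h
      · exact hZ₂' z h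
    have hout : ∃ k : Fin 4, k ≠ 0 ∧ (z k < -(3 * (ℓ : ℤ) + 3) ∨ 3 * (ℓ : ℤ) + 2 < z k) := by
      rcases Finset.mem_union.1 hz' with h | h
      · exact hD₁' z h
      · exact hD₂' z h
    obtain ⟨k, hk, h⟩ := hout
    have := hin k hk
    omega
  obtain ⟨⟨hττ, hτadj⟩, ⟨hτ'τ', hτ'adj⟩⟩ := collar_flips_invol ℓ τ τ' hτ hτ' y
  by_cases hyD : y ∈ D₁ ∪ D₂
  · have h1 : σ y = τ' y := by rw [hσ, if_pos hyD]
    have hD' : τ' y ∈ D₁ ∪ D₂ := by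
      rcases Finset.mem_union.1 hyD with h | h
      · exact Finset.mem_union_left _ (hD₁ y h)
      · exact Finset.mem_union_right _ (hD₂ y h)
    refine ⟨?_, ?_, 0, ?_⟩
    · rw [h1]
      rcases Finset.mem_union.1 hD' with h | h
      · exact Finset.mem_union_left _ (Finset.mem_union_right _ h)
      · exact Finset.mem_union_right _ (Finset.mem_union_right _ h)
    · rw [h1, hσ, if_pos hD', hτ'τ']
    · rw [h1]; exact hτ'adj
  · have hyZ : y ∈ Z₁ ∪ Z₂ := by
      simp only [Finset.mem_union, not_or] at hy hyD ⊢
      tauto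
    have h1 : σ y = τ y := by rw [hσ, if_neg hyD]
    have hZ' : τ y ∈ Z₁ ∪ Z₂ := by
      rcases Finset.mem_union.1 hyZ with h | h
      · exact Finset.mem_union_left _ (hZ₁ y h)
      · exact Finset.mem_union_right _ (hZ₂ y h)
    refine ⟨?_, ?_, 0, ?_⟩
    · rw [h1]
      rcases Finset.mem_union.1 hZ' with h | h
      · exact Finset.mem_union_left _ (Finset.mem_union_left _ h)
      · exact Finset.mem_union_right _ (Finset.mem_union_left _ h)
    · rw [h1, hσ, if_neg (disj _ hZ'), hττ]
    · rw [h1]; exact hτadj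

/-- **The links of one placement** (`star(a) ∪ Q` in the chart): their endpoints are exactly `Z ∪ D`, lie in
the window `[-3ℓ-4, 3ℓ+3]⁴`, and no link has both endpoints in `Ŵ` or both outside `Λ̂`. [folklore] -/
theorem collar_point_links (ℓ : ℕ) (a b c : Site 4) (M : Finset (Fin 4)) (Q : Finset (Site 4 × Fin 4))
    (Z D : Finset (Site 4))
    (haΛ : ∀ i, -(3 * (ℓ : ℤ) + 3) ≤ a i ∧ a i ≤ 3 * ℓ + 2) (haW : ¬ ∀ i, -(ℓ : ℤ) - 1 ≤ a i ∧ a i ≤ ℓ)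
    (hb : ∀ i, -(3 * (ℓ : ℤ) + 2) ≤ b i ∧ b i ≤ 3 * ℓ + 2)
    (h5 : ∀ q ∈ Q, ∃ w : Site 4, (∀ i, -2 ≤ w i ∧ w i ≤ 1) ∧
        (∀ i, -2 ≤ (w + Pi.single q.2 1 : Site 4) i ∧ (w + Pi.single q.2 1 : Site 4) i ≤ 1) ∧
        q.1 = b + w ∧ ¬ ((∃ k ∈ M, w k = c k) ∧ (∃ k ∈ M, (w + Pi.single q.2 1 : Site 4) k = c k)))
    (h6 : ∀ q ∈ Q, ¬ ((∀ i, -(ℓ : ℤ) - 1 ≤ q.1 i ∧ q.1 i ≤ ℓ) ∧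
        (∀ i, -(ℓ : ℤ) - 1 ≤ (q.1 + Pi.single q.2 1 : Site 4) i ∧ (q.1 + Pi.single q.2 1 : Site 4) i ≤ ℓ)))
    (h7 : ∀ q ∈ Q, (∀ i, -(3 * (ℓ : ℤ) + 3) ≤ q.1 i ∧ q.1 i ≤ 3 * ℓ + 2) ∨
        (∀ i, -(3 * (ℓ : ℤ) + 3) ≤ (q.1 + Pi.single q.2 1 : Site 4) i ∧
          (q.1 + Pi.single q.2 1 : Site 4) i ≤ 3 * ℓ + 2))
    (h8 : ∀ y : Site 4, (y ∈ Z ∨ y ∈ D) ↔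
        ((y = a ∨ ∃ μ : Fin 4, y = a + Pi.single μ 1 ∨ y = a - Pi.single μ 1) ∨
          ∃ q ∈ Q, q.1 = y ∨ q.1 + Pi.single q.2 1 = y)) :
    (∀ y : Site 4, (∃ q ∈ (Finset.univ.image fun μ : Fin 4 => (a, μ)) ∪
        (Finset.univ.image fun μ : Fin 4 => (a - Pi.single μ 1, μ)) ∪ Q, q.1 = y ∨ q.1 + Pi.single q.2 1 = y) ↔
        (y ∈ Z ∨ y ∈ D)) ∧
    (∀ q ∈ (Finset.univ.image fun μ : Fin 4 => (a, μ)) ∪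
        (Finset.univ.image fun μ : Fin 4 => (a - Pi.single μ 1, μ)) ∪ Q,
      (∀ i, -(3 * (ℓ : ℤ) + 4) ≤ q.1 i ∧ q.1 i ≤ 3 * ℓ + 3) ∧
      (∀ i, -(3 * (ℓ : ℤ) + 4) ≤ (q.1 + Pi.single q.2 1 : Site 4) i ∧ (q.1 + Pi.single q.2 1 : Site 4) i ≤ 3 * ℓ + 3) ∧
      ¬ ((∀ i, -(ℓ : ℤ) - 1 ≤ q.1 i ∧ q.1 i ≤ ℓ) ∧
        (∀ i, -(ℓ : ℤ) - 1 ≤ (q.1 + Pi.single q.2 1 : Site 4) i ∧ (q.1 + Pi.single q.2 1 : Site 4) i ≤ ℓ)) ∧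
      ((∀ i, -(3 * (ℓ : ℤ) + 3) ≤ q.1 i ∧ q.1 i ≤ 3 * ℓ + 2) ∨
        (∀ i, -(3 * (ℓ : ℤ) + 3) ≤ (q.1 + Pi.single q.2 1 : Site 4) i ∧
          (q.1 + Pi.single q.2 1 : Site 4) i ≤ 3 * ℓ + 2))) := by
  classical
  have hmem : ∀ q : Site 4 × Fin 4, q ∈ (Finset.univ.image fun μ : Fin 4 => (a, μ)) ∪
      (Finset.univ.image fun μ : Fin 4 => (a - Pi.single μ 1, μ)) ∪ Q ↔
      ((∃ μ, q = (a, μ)) ∨ ∃ μ, q = (a - Pi.single μ 1, μ)) ∨ q ∈ Q := by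
    intro q
    simp only [Finset.mem_union, Finset.mem_image, Finset.mem_univ, true_and]
    constructor
    · rintro ((⟨μ, h⟩ | ⟨μ, h⟩) | h)
      · exact Or.inl (Or.inl ⟨μ, h.symm⟩)
      · exact Or.inl (Or.inr ⟨μ, h.symm⟩)
      · exact Or.inr h
    · rintro ((⟨μ, h⟩ | ⟨μ, h⟩) | h)
      · exact Or.inl (Or.inl ⟨μ, h.symm⟩)
      · exact Or.inl (Or.inr ⟨μ, h.symm⟩)
      · exact Or.inr h
  constructor
  · intro y
    rw [h8]
    constructor
    · rintro ⟨q, hq, h⟩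
      rcases (hmem q).1 hq with (⟨μ, rfl⟩ | ⟨μ, rfl⟩) | hq
      · rcases h with h | h
        · exact Or.inl (Or.inl h.symm)
        · exact Or.inl (Or.inr ⟨μ, Or.inl h.symm⟩)
      · rcases h with h | h
        · exact Or.inl (Or.inr ⟨μ, Or.inr h.symm⟩)
        · left; left; rw [← h]; simp
      · exact Or.inr ⟨q, hq, h⟩
    · rintro ((rfl | ⟨μ, rfl | rfl⟩) | ⟨q, hq, h⟩)
      · exact ⟨(y, 0), (hmem _).2 (Or.inl (Or.inl ⟨0, rfl⟩)), Or.inl rfl⟩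
      · exact ⟨(a, μ), (hmem _).2 (Or.inl (Or.inl ⟨μ, rfl⟩)), Or.inr rfl⟩
      · exact ⟨(a - Pi.single μ 1, μ), (hmem _).2 (Or.inl (Or.inr ⟨μ, rfl⟩)), Or.inl rfl⟩
      · exact ⟨q, (hmem _).2 (Or.inr hq), h⟩
  · intro q hq
    rcases (hmem q).1 hq with (⟨μ, rfl⟩ | ⟨μ, rfl⟩) | hq
    · refine ⟨fun i => by have := haΛ i; dsimp only; omega, fun i => ?_, fun h => haW h.1, Or.inl haΛ⟩
      have := haΛ i
      by_cases hi : i = μ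
      · subst hi; simp; omega
      · simp [hi]; omega
    · refine ⟨fun i => ?_, fun i => by have := haΛ i; simp; omega, fun h => haW (by simpa using h.2),
        Or.inr (by simpa using haΛ)⟩
      have := haΛ i
      by_cases hi : i = μ
      · subst hi; simp; omega
      · simp [hi]; omega
    · obtain ⟨w, hw, hw', hq1, -⟩ := h5 q hq
      refine ⟨fun i => ?_, fun i => ?_, h6 q hq, h7 q hq⟩
      · have := hw i; have := hb i; rw [hq1]; simp only [Pi.add_apply]; omega
      · have h1 := hw' i; have h2 := hb i; rw [hq1]
        simp only [Pi.add_apply] at h1 ⊢; omega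

/-- **Registered helper `stub_placementCollar_aux4` of crux stmt-QuantumFields-17375** (line `pad-the-fibre`, stub
`stub_placementCollar`): the one-point package of the collar recipe (integer chart) — one line (`collar_point_package`). [folklore] -/
theorem stub_placementCollar_aux4 : ∀ (ℓ : ℕ) (_ : 1 ≤ ℓ) (a : Site 4) (_ : ∀ i, -(3 * (ℓ : ℤ) + 3) ≤ a i ∧ a i ≤ 3 * ℓ + 2) (_ : ¬ ∀ i, -(ℓ : ℤ) - 1 ≤ a i ∧ a i ≤ ℓ), ∃ (b c : Site 4) (M : Finset (Fin 4)) (Q : Finset (Site 4 × Fin 4)) (Z D : Finset (Site 4)), (∀ i, a i - b i = 0 ∨ a i - b i = -1) ∧ (∀ i, -(3 * (ℓ : ℤ) + 2) ≤ b i ∧ b i ≤ 3 * ℓ + 2) ∧ (∀ k ∈ M, c k = -2 ∨ c k = 1) ∧ (∀ w : Site 4, (∀ i, -2 ≤ w i ∧ w i ≤ 1) → ∀ μ : Fin 4, (∀ i, -2 ≤ (w + Pi.single μ 1 : Site 4) i ∧ (w + Pi.single μ 1 : Site 4) i ≤ 1) → (¬ ∃ k ∈ M, w k = c k) → (¬ ∃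 k ∈ M, (w + Pi.single μ 1 : Site 4) k = c k) → (b + w, μ) ∈ Q) ∧ (∀ q ∈ Q, ∃ w : Site 4, (∀ i, -2 ≤ w i ∧ w i ≤ 1) ∧ (∀ i, -2 ≤ (w + Pi.single q.2 1 : Site 4) i ∧ (w + Pi.single q.2 1 : Site 4) i ≤ 1) ∧ q.1 = b + w ∧ ¬ ((∃ k ∈ M, w k = c k) ∧ (∃ k ∈ M, (w + Pi.single q.2 1 : Site 4) k = c k))) ∧ (∀ q ∈ Q, ¬ ((∀ i, -(ℓ : ℤ) - 1 ≤ q.1 i ∧ q.1 i ≤ ℓ) ∧ (∀ i, -(ℓ : ℤ) - 1 ≤ (q.1 + Pi.single q.2 1 : Site 4) i ∧ (q.1 + Pi.single q.2 1 : Site 4) i ≤ ℓ))) ∧ (∀ q ∈ Q, (∀ i, -(3 * (ℓ : ℤ) + 3) ≤ q.1 i ∧ q.1 i ≤ 3 * ℓ + 2) ∨ (∀ i, -(3 * (ℓ : ℤ) + 3) ≤ (q.1 + Pi.single q.2 1 : Site 4) i ∧ (q.1 + Pi.single q.2 1 : Site 4) i ≤ 3 * ℓ + 2)) ∧ (∀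 y : Site 4, (y ∈ Z ∨ y ∈ D) ↔ ((y = a ∨ ∃ μ : Fin 4, y = a + Pi.single μ 1 ∨ y = a - Pi.single μ 1) ∨ ∃ q ∈ Q, q.1 = y ∨ q.1 + Pi.single q.2 1 = y)) ∧ (∀ y ∈ Z, (if (y 0 - (ℓ : ℤ)) % 2 = 0 then y + Pi.single 0 1 else y - Pi.single 0 1) ∈ Z) ∧ (∀ y ∈ D, (if (y 0 - (ℓ : ℤ)) % 2 = 0 then y - Pi.single 0 1 else y + Pi.single 0 1) ∈ D) ∧ (∀ y ∈ Z, ∀ k : Fin 4, k ≠ 0 → -(3 * (ℓ : ℤ) + 3) ≤ y k ∧ y k ≤ 3 * ℓ + 2) ∧ (∀ y ∈ D, ∃ k : Fin 4, k ≠ 0 ∧ (y k < -(3 * (ℓ : ℤ) + 3) ∨ 3 * (ℓ : ℤ) + 2 < y k)) ∧ (∀ y : Site 4, y ∈ Z ∨ y ∈ D → ∀ i, -(3 * (ℓ : ℤ) + 4) ≤ y i ∧ y i ≤ 3 * ℓ + 3) :=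
  collar_point_package

end Summit.QuantumFields.QCD.Theorems.PadTheFibreCollar

end
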